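import Summits.QuantumFields.BalabanUV.Beta.GAN24.LayerLetterEnd

/-!
# `BalabanUV.Beta.GAN24.LayerLetterLiteral` — binder row G-an2-4 ∕ (CONV-C), W-slot CT-W, route «WC-TL» ∕ (Q-R) «QR-LL», row (LAY), programme «(LAY-LIT)», PART 7:
# **THE LITERAL, PER LEVEL** — PART 6b instantiated at the objects of p2 PART 5 `WardResidualSUnrolled.exists_kernelLaws_unrolled` at level `m`
# (`G_m = coDressKBmAt ρ Lc (KInvStep Lc m)`, `SpureRecAt … m`, `M1At … m`, `M2Of d Lc mixFF m`, `(stepScale m·Lc^{d+1})⁻¹`, `−Lc^{d+1}·wE (m+1)`), the four classes taken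
# from the tree BY NAME at ONE common rate: `∃ Cs r δ′` (LEVEL-DEPENDENT — honest) with the END's `hS` shape for every label box and `hω := FaceSum` itself
# (G-an2-4 formalisation swarm → CRUX TEAM (2), leaf prover `b2b-balaban-gan24-formalise-leaf-03`, gen 61; INTENT 7; names PROVISIONAL)

NOT IN PRINT; OUR BOOKKEEPING ([folklore] `LayerLetterEnd.abs_unitS_superblock_sum_le'` ⨾ `AxialDressingRootedBmHessian.decays_coDressKBmAt_KInvStep`,
`SpineRooted.locStencil_SpureRecAt ∕ vertexFamily_M1At`, `BalabanStepW2.locStencilFM_M2Of`, `LocStencilFM.mono`, `locStencil_mono`, `decays_weaken` BY NAME; 0 `def`, 0 cited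
facts, 0 `def … : Prop`, 0 sorry).  HONEST FRAMING (cell contract, verbatim): «discharging `BetaPertH` makes Bałaban's UV stability UNCONDITIONAL — a real constructive-QFT result;
it is NOT the continuum limit and NOT the Clay problem.»  HONEST DEPENDENCY (verbatim): «continuum YM on T⁴ ⇐ BetaPertH ∧ nine spine estimates (0/9 proved); BetaPertH ⇐ (D1) ∧
(D4) ∧ CAP+tail; G-an2-4 gates asym, D1 and NE2/3/4.»

WHAT.  **`exists_letterProfile_literal`**: for an in-block root `r`, `cΛ`, a mixed table `mixFF` in an1's class (`hmix`), `RM ∕ Ψ` as in PART 5 (the mixed law `hM₂` and the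
explicit first-order data `hΨ`, VERBATIM shapes), a level `m` and the level-`m` sandwich letter `σm` (`hσ` — the `RB ≡ RB″ ≡ 0` literal, `source_eq_sandwich_of_border`):
`∃ Cs r δ′ ≥∕> 0, ∀ sf sm M′ y κ u x z a b, |unitS sf sm (Σ_{w∈box M′} σm (M′•y + w)) κ u x z a b| ≤ (|(sf·sm)⁻¹|·max(|sf⁻¹|,|sm⁻¹|)²·Cs)·FaceSum_{(Lc·M′, y)}^{δ′}(u)·e^{−r(‖x−u‖₁+‖z−u‖₁)}`
— the END's `hS` for every sub-letter of level `m` with `hω := ⟨faceSum_nonneg, le_rfl⟩`, constants depending on `m` through the tree's per-level classes.  WHAT IS NOT HERE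
(the located open content of the (LAY) row): `Cs, r, δ′` UNIFORM IN `m` (in units) — `decays_coDressKBmAt_KInvStep ∕ locStencil_SpureRecAt` are `∃` PER LEVEL.  DISCHARGES NO
ROW by itself; NEVER «G-an2-4 closed» as (CONV-C); NOT D1, NOT `BetaPertH`, NOT continuum, NOT Clay.  2026-08-22.
-/

noncomputable section

namespace Summit.QuantumFields.BalabanUV.Beta.GAN24.LayerLetterLiteral

open Finset
open scoped BigOperators
open Literature.MathematicalPhysics.QuantumFieldTheory
open Literature.MathematicalPhysics.QuantumFieldTheory.Balaban1983to89
open Literature.MathematicalPhysics.QuantumFieldTheory.Balaban1983to89.Beta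
open Literature.MathematicalPhysics.QuantumFieldTheory.Balaban1983to89.B12Sec2to5 (l1 l1_nonneg)
open B6BondElimination (unitVec)
open ExpKernelCalculus (MKer Site BiLoc Decays VertexFamily comp Zl Zl_nonneg)
open OneStepResolventKernel (Fib LocStencil wsum)
open OneStepKernelFamily (KInvStep)
open SecondOrderResponse (vertexOfM dM LocStencilFM)
open InterLevelTransport (cwsum)
open KernelWard (divV)
open StepJetData (decays_weaken)
open BalabanStepJets (locStencil_mono)
open BalabanStepJetsSucc (mmRead wE)
open BalabanStepW2 (M2Of locStencilFM_M2Of)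
open AffineAveraging (box toSite)
open Summit.QuantumFields.BalabanUV.Beta.ChartConjugation (conjV)
open Summit.QuantumFields.BalabanUV.Beta.BorderedHessian (diagK stepScale)
open Summit.QuantumFields.BalabanUV.Beta.AveragingWardRootedStencils (legInd)
open Summit.QuantumFields.BalabanUV.Beta.KernelWardRelative (gaugeWt)
open Summit.QuantumFields.BalabanUV.Beta.AxialDressingRooted (coDressKBmAt decays_coDressKBmAt_KInvStep)
open Summit.QuantumFields.BalabanUV.Beta.SpineRooted (SpureRecAt M1At locStencil_SpureRecAt vertexFamily_M1At)
open Summit.QuantumFields.BalabanUV.Beta.HessKerDressedUnits (unitS)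
open Summit.QuantumFields.BalabanUV.Beta.GAN24.LayerLetterEnd (abs_unitS_superblock_sum_le')

variable {d Lc : ℕ} [NeZero Lc]

/-- NOT IN PRINT; OUR BOOKKEEPING.  **THE LITERAL's LETTER PROFILE, PER LEVEL** (PART 6b at the objects of p2 PART 5, classes by name at the common rate
`δ₀ = min δ_G (min δ_S δ_mix)`; `∃` constants — LEVEL-DEPENDENT). -/
theorem exists_letterProfile_literal {r : Fin (d + 1) → ℕ} (hr : r ∈ box (d + 1) Lc) (cΛ : ℝ)
    {mixFF : Fin (d + 1) → Site (d + 1) → Fin (d + 1) → Site (d + 1) → MKer (d + 1) (Fib d)} (hmix : ∃ C δ : ℝ, 0 < δ ∧ LocStencilFM Lc mixFF C δ)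
    {RM Ψ : ℕ → Site (d + 1) → Fin (d + 1) → Site (d + 1) → MKer (d + 1) (Fib d)}
    (hM₂ : ∀ (j : ℕ) (y : Site (d + 1)) (ρ' : Fin (d + 1)) (w : Site (d + 1)),
      (stepScale d Lc j * (Lc : ℝ) ^ (d + 1))⁻¹ • ∑ v ∈ box (d + 1) Lc, divV (fun κ u => M2Of d Lc mixFF j κ u ρ' w) ((Lc : ℤ) • y + toSite v) =
        comp (M1At d Lc (toSite r) cΛ j ρ' w) (diagK (((1 : ℝ) / 2) • ∑ v ∈ box (d + 1) Lc, legInd (toSite r) ((Lc : ℤ) • y + toSite v)))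
          - comp (diagK (((1 : ℝ) / 2) • ∑ v ∈ box (d + 1) Lc, legInd (toSite r) ((Lc : ℤ) • y + toSite v))) (M1At d Lc (toSite r) cΛ j ρ' w) + RM j y ρ' w)
    (hΨ : ∀ (j : ℕ) (y : Site (d + 1)) (ν : Fin (d + 1)) (y' : Site (d + 1)), Ψ j y ν y' =
      vertexOfM (coDressKBmAt (toSite r) Lc (KInvStep (d := d) Lc j)) Lc (RM j y) ν y'
      + (1 / 2 : ℝ) • (dM (conjV (coDressKBmAt (toSite r) Lc (KInvStep (d := d) Lc j))
              (diagK (((1 : ℝ) / 2) • ∑ v ∈ box (d + 1) Lc, legInd (toSite r) ((Lc : ℤ) • y + toSite v)))) Lc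
            (SpureRecAt d Lc (toSite r) ((Lc : ℝ) ^ (d + 1)) (-((Lc : ℝ) ^ (d + 1) * (1 / 2) * (Lc : ℝ) ^ (d + 1))) cΛ j)
            (M1At d Lc (toSite r) cΛ j) ν y'
        - (stepScale d Lc j * (Lc : ℝ) ^ (d + 1))⁻¹ • (∑ κ, wsum (fun u => ∑' x₂, ∑ κ₂,
              comp (coDressKBmAt (toSite r) Lc (KInvStep (d := d) Lc j))
                (dM (coDressKBmAt (toSite r) Lc (KInvStep (d := d) Lc j)) Lc
                  (SpureRecAt d Lc (toSite r) ((Lc : ℝ) ^ (d + 1)) (-((Lc : ℝ) ^ (d + 1) * (1 / 2) * (Lc : ℝ) ^ (d + 1))) cΛ j)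
                  (M1At d Lc (toSite r) cΛ j) ν y') u x₂ (Sum.inl κ) (Sum.inl κ₂) * gaugeWt Lc y κ₂ x₂)
              (SpureRecAt d Lc (toSite r) ((Lc : ℝ) ^ (d + 1)) (-((Lc : ℝ) ^ (d + 1) * (1 / 2) * (Lc : ℝ) ^ (d + 1))) cΛ j κ)
            + ∑ ρ', cwsum Lc (fun w => ∑' x₂, ∑ κ₂,
              comp (coDressKBmAt (toSite r) Lc (KInvStep (d := d) Lc j))
                (dM (coDressKBmAt (toSite r) Lc (KInvStep (d := d) Lc j)) Lc
                  (SpureRecAt d Lc (toSite r) ((Lc : ℝ) ^ (d + 1)) (-((Lc : ℝ) ^ (d + 1) * (1 / 2) * (Lc : ℝ) ^ (d + 1))) cΛ j)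
                  (M1At d Lc (toSite r) cΛ j) ν y') ((Lc : ℤ) • w) x₂ (Sum.inr ρ') (Sum.inl κ₂) * gaugeWt Lc y κ₂ x₂)
              (M1At d Lc (toSite r) cΛ j ρ'))))
    (m : ℕ) {σm : Site (d + 1) → Fin (d + 1) → Site (d + 1) → MKer (d + 1) (Fib d)}
    (hσ : ∀ (Y' : Site (d + 1)) (κ : Fin (d + 1)) (u : Site (d + 1)), σm Y' κ u =
      (-((Lc : ℝ) ^ (d + 1) * wE d Lc (m + 1))) • ∑ v ∈ box (d + 1) Lc,
        mmRead Lc (comp (comp (coDressKBmAt (toSite r) Lc (KInvStep (d := d) Lc m)) (Ψ m ((Lc : ℤ) • Y' + toSite v) κ u))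
          (coDressKBmAt (toSite r) Lc (KInvStep (d := d) Lc m)))) :
    ∃ Cs rate δ' : ℝ, 0 < rate ∧ 0 < δ' ∧ ∀ (sf sm : ℝ) (M' : ℕ) (y : Site (d + 1)) (κ : Fin (d + 1)) (u x z : Site (d + 1)) (a b : Fib d),
      |unitS sf sm (∑ w ∈ box (d + 1) M', σm ((M' : ℤ) • y + toSite w)) κ u x z a b|
        ≤ (|(sf * sm)⁻¹| * (max |sf⁻¹| |sm⁻¹|) ^ 2 * Cs)
          * (∑ μ : Fin (d + 1),
              (∑ v ∈ ((box (d + 1) (Lc * M')).filter (fun t => t μ = Lc * M' - 1)).image (fun t => ((Lc * M' : ℕ) : ℤ) • y + toSite t),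
                  Real.exp (-δ' * l1 (v - u))
                + ∑ v ∈ ((box (d + 1) (Lc * M')).filter (fun t => t μ = 0)).image (fun t => ((Lc * M' : ℕ) : ℤ) • y + toSite t - unitVec μ),
                    Real.exp (-δ' * l1 (v - u))))
          * Real.exp (-rate * (l1 (x - u) + l1 (z - u))) := by
  have hLc : 1 ≤ Lc := Nat.one_le_iff_ne_zero.2 (NeZero.ne Lc)
  obtain ⟨δG, CG, hδG, hCG, hG⟩ := decays_coDressKBmAt_KInvStep (d := d) hr m
  obtain ⟨Cs, δS, hδS, hS⟩ := locStencil_SpureRecAt hLc hr ((Lc : ℝ) ^ (d + 1)) (-((Lc : ℝ) ^ (d + 1) * (1 / 2) * (Lc : ℝ) ^ (d + 1))) cΛ m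
  obtain ⟨Cx, δx, hδx, hx⟩ := hmix
  set δ : ℝ := min δG (min δS δx) with hδdef
  have hδ : 0 < δ := lt_min hδG (lt_min hδS hδx)
  have hδ1 : δ ≤ δG := min_le_left _ _
  have hδ2 : δ ≤ δS := (min_le_right _ _).trans (min_le_left _ _)
  have hδ3 : δ ≤ δx := (min_le_right _ _).trans (min_le_right _ _)
  have hG' : Decays (coDressKBmAt (toSite r) Lc (KInvStep (d := d) Lc m)) CG δ := decays_weaken hG le_rfl hδ1
  have hCs0 : 0 ≤ Cs := (hS 0 0).nonneg (Sum.inl 0)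
  have hS' := locStencil_mono hS hCs0 hδ2
  have hM := vertexFamily_M1At hLc hr cΛ m hδ.le
  have hM2 := (locStencilFM_M2Of hx m).mono hδ3
  refine ⟨?_, δ / 32, δ / 4, by positivity, by positivity, fun sf sm M' y κ u x z a b => ?_⟩
  swap
  · exact abs_unitS_superblock_sum_le' hG' hδ hS' hM hM2 (fun y ρ' w => hM₂ m y ρ' w) (fun y ν y' => hΨ m y ν y') hσ sf sm M' y κ u x z a b

/-- NOT IN PRINT; OUR BOOKKEEPING.  The same at the END's indexing (label box side `Lc^k`, ONE face block of side `Lc^(k+1)` at the Λ_n-label `y`; for the OWNER's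
`WardRemainderEndThreeSplit` take `y := Lc•Y + toSite v`). -/
theorem exists_letterProfile_literal_pow {r : Fin (d + 1) → ℕ} (hr : r ∈ box (d + 1) Lc) (cΛ : ℝ)
    {mixFF : Fin (d + 1) → Site (d + 1) → Fin (d + 1) → Site (d + 1) → MKer (d + 1) (Fib d)} (hmix : ∃ C δ : ℝ, 0 < δ ∧ LocStencilFM Lc mixFF C δ)
    {RM Ψ : ℕ → Site (d + 1) → Fin (d + 1) → Site (d + 1) → MKer (d + 1) (Fib d)}
    (hM₂ : ∀ (j : ℕ) (y : Site (d + 1)) (ρ' : Fin (d + 1)) (w : Site (d + 1)),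
      (stepScale d Lc j * (Lc : ℝ) ^ (d + 1))⁻¹ • ∑ v ∈ box (d + 1) Lc, divV (fun κ u => M2Of d Lc mixFF j κ u ρ' w) ((Lc : ℤ) • y + toSite v) =
        comp (M1At d Lc (toSite r) cΛ j ρ' w) (diagK (((1 : ℝ) / 2) • ∑ v ∈ box (d + 1) Lc, legInd (toSite r) ((Lc : ℤ) • y + toSite v)))
          - comp (diagK (((1 : ℝ) / 2) • ∑ v ∈ box (d + 1) Lc, legInd (toSite r) ((Lc : ℤ) • y + toSite v))) (M1At d Lc (toSite r) cΛ j ρ' w) + RM j y ρ' w)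
    (hΨ : ∀ (j : ℕ) (y : Site (d + 1)) (ν : Fin (d + 1)) (y' : Site (d + 1)), Ψ j y ν y' =
      vertexOfM (coDressKBmAt (toSite r) Lc (KInvStep (d := d) Lc j)) Lc (RM j y) ν y'
      + (1 / 2 : ℝ) • (dM (conjV (coDressKBmAt (toSite r) Lc (KInvStep (d := d) Lc j))
              (diagK (((1 : ℝ) / 2) • ∑ v ∈ box (d + 1) Lc, legInd (toSite r) ((Lc : ℤ) • y + toSite v)))) Lc
            (SpureRecAt d Lc (toSite r) ((Lc : ℝ) ^ (d + 1)) (-((Lc : ℝ) ^ (d + 1) * (1 / 2) * (Lc : ℝ) ^ (d + 1))) cΛ j)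
            (M1At d Lc (toSite r) cΛ j) ν y'
        - (stepScale d Lc j * (Lc : ℝ) ^ (d + 1))⁻¹ • (∑ κ, wsum (fun u => ∑' x₂, ∑ κ₂,
              comp (coDressKBmAt (toSite r) Lc (KInvStep (d := d) Lc j))
                (dM (coDressKBmAt (toSite r) Lc (KInvStep (d := d) Lc j)) Lc
                  (SpureRecAt d Lc (toSite r) ((Lc : ℝ) ^ (d + 1)) (-((Lc : ℝ) ^ (d + 1) * (1 / 2) * (Lc : ℝ) ^ (d + 1))) cΛ j)
                  (M1At d Lc (toSite r) cΛ j) ν y') u x₂ (Sum.inl κ) (Sum.inl κ₂) * gaugeWt Lc y κ₂ x₂)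
              (SpureRecAt d Lc (toSite r) ((Lc : ℝ) ^ (d + 1)) (-((Lc : ℝ) ^ (d + 1) * (1 / 2) * (Lc : ℝ) ^ (d + 1))) cΛ j κ)
            + ∑ ρ', cwsum Lc (fun w => ∑' x₂, ∑ κ₂,
              comp (coDressKBmAt (toSite r) Lc (KInvStep (d := d) Lc j))
                (dM (coDressKBmAt (toSite r) Lc (KInvStep (d := d) Lc j)) Lc
                  (SpureRecAt d Lc (toSite r) ((Lc : ℝ) ^ (d + 1)) (-((Lc : ℝ) ^ (d + 1) * (1 / 2) * (Lc : ℝ) ^ (d + 1))) cΛ j)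
                  (M1At d Lc (toSite r) cΛ j) ν y') ((Lc : ℤ) • w) x₂ (Sum.inr ρ') (Sum.inl κ₂) * gaugeWt Lc y κ₂ x₂)
              (M1At d Lc (toSite r) cΛ j ρ'))))
    (m : ℕ) {σm : Site (d + 1) → Fin (d + 1) → Site (d + 1) → MKer (d + 1) (Fib d)}
    (hσ : ∀ (Y' : Site (d + 1)) (κ : Fin (d + 1)) (u : Site (d + 1)), σm Y' κ u =
      (-((Lc : ℝ) ^ (d + 1) * wE d Lc (m + 1))) • ∑ v ∈ box (d + 1) Lc,
        mmRead Lc (comp (comp (coDressKBmAt (toSite r) Lc (KInvStep (d := d) Lc m)) (Ψ m ((Lc : ℤ) • Y' + toSite v) κ u))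
          (coDressKBmAt (toSite r) Lc (KInvStep (d := d) Lc m)))) :
    ∃ Cs rate δ' : ℝ, 0 < rate ∧ 0 < δ' ∧ ∀ (sf sm : ℝ) (k : ℕ) (y : Site (d + 1)) (κ : Fin (d + 1)) (u x z : Site (d + 1)) (a b : Fib d),
      |unitS sf sm (∑ w ∈ box (d + 1) (Lc ^ k), σm (((Lc ^ k : ℕ) : ℤ) • y + toSite w)) κ u x z a b|
        ≤ (|(sf * sm)⁻¹| * (max |sf⁻¹| |sm⁻¹|) ^ 2 * Cs)
          * (∑ μ : Fin (d + 1),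
              (∑ v ∈ ((box (d + 1) (Lc ^ (k + 1))).filter (fun t => t μ = Lc ^ (k + 1) - 1)).image (fun t => ((Lc ^ (k + 1) : ℕ) : ℤ) • y + toSite t),
                  Real.exp (-δ' * l1 (v - u))
                + ∑ v ∈ ((box (d + 1) (Lc ^ (k + 1))).filter (fun t => t μ = 0)).image (fun t => ((Lc ^ (k + 1) : ℕ) : ℤ) • y + toSite t - unitVec μ),
                    Real.exp (-δ' * l1 (v - u))))
          * Real.exp (-rate * (l1 (x - u) + l1 (z - u))) := by
  obtain ⟨Cs, rate, δ', hrate, hδ', h⟩ := exists_letterProfile_literal hr cΛ hmix hM₂ hΨ m hσ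
  refine ⟨Cs, rate, δ', hrate, hδ', fun sf sm k y κ u x z a b => ?_⟩
  have h1 := h sf sm (Lc ^ k) y κ u x z a b
  rw [← pow_succ'] at h1
  exact h1

end Summit.QuantumFields.BalabanUV.Beta.GAN24.LayerLetterLiteral

end
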